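import Mathlib
import HarnessLib
import Summits.HubbardSuperconductivity.HubbardSuperconductivity.Theorems.KLProgrammeC4aKernelBumpRows

/-!
# Route `KLProgramme` — crux C4a, S3 brick (B4) «(U1)-HYBRID», «SWAP-BY-SYMMETRY» part 4: the two WEIGHTED kernel rows of U7 for the bumped family
# `χ(u)·Kr(e,u)/C` — flatness `hflat` (at the modified weight `wt·χ(D − ·)`) and the negative-level majorant `hKn1` (+ `hρ0/hρc/hρtail`)

Cell `gate-hubbard-kl`, seat hubbard-kl-k3c3-p3 (g38; row «implicit-function / monotonicity route for μ(n)»).  Companion of `…C4aKernelBumpRows` (the nine weight-free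
rows); memo HOME/hubbard-kl-k3c3-p3/SWAP-BY-SYMMETRY.md.
* `lipschitzAnchor_mul_bump` — the Lipschitz anchor `|wt(e)χ(D−e) − wt(lo)χ(D−lo)| ≤ (W′ + W·B₁)(e − lo)` that k3c3-p1's `farS_hflat_row` wants for the modified weight;
* **`bumpKernel_hflat`** — from the flatness of `Kr` AT THE MODIFIED WEIGHT `wt·χ(D − ·)` and the value envelope `hK0`: `Afl ↦ Afl/C`,
  `Bfl ↦ (Bfl + W·B₁·r⁻¹·(hi − lo))/C` (the `χ′(D−e)·Kr(e,D−e)` term lives on `|D − e| > r`, where `|Kr| ≤ r⁻¹`);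
* **`bumpKernel_hKn1`** — from `hKn1` (`ρm`) and a value majorant `ρv` of `Kr(−s,·)` on `|u| > r` in the row's own shape: `ρm ↦ (ρm + B₁ρv)/C`;
  **`bumpKernel_hρ`** — `hρ0`, `hρc`, `hρtail` for the new majorant (`Mρ ↦ (Mρ + B₁Mv)/C`).
Pure one-variable calculus; nothing about the model; nothing asserts (C), K3, the window or superconductivity.
References: BGM 2006 §2.4 (2.36) [cite: BenfattoGiulianiMastropietro2006]; FST II CPAM 51 (1998) §3 [cite: FeldmanSalmhoferTrubowitz1998].
-/

noncomputable section

namespace Summit.HubbardSuperconductivity.HubbardSuperconductivity.Theorems.C4a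

set_option linter.dupNamespace false -- summit = problem name (single-conjunct summit), D-0017

open Real Set Filter MeasureTheory intervalIntegral
open scoped Topology Interval

/-! ## The two rows that see the level weight: flatness and the negative-level majorant -/

section Weighted

variable {χ : ℝ → ℝ} (hχ : ContDiff ℝ 2 χ) {Bχ₁ rχ : ℝ} (hχ0 : ∀ u, |χ u| ≤ 1) (hχ1 : ∀ u, |deriv χ u| ≤ Bχ₁)
  (hχ1r : ∀ u, |u| ≤ rχ → deriv χ u = 0) (hrχ : 0 < rχ)
  {Kr : ℝ → ℝ → ℝ} {lo hi C : ℝ} (hlo : 0 < lo) (hlohi : lo ≤ hi) (hC1 : 1 ≤ C)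

/-- **Lipschitz anchor of the modified weight**: `|wt(e)χ(D−e) − wt(lo)χ(D−lo)| ≤ (W′ + W·B₁)(e − lo)` on `[lo,hi]`. -/
theorem lipschitzAnchor_mul_bump (hχd : Differentiable ℝ χ) (hχ0 : ∀ u, |χ u| ≤ 1) (hχ1 : ∀ u, |deriv χ u| ≤ Bχ₁) {wt : ℝ → ℝ} {W W' : ℝ}
    (hwW : ∀ e ∈ Icc lo hi, |wt e| ≤ W) (hW' : 0 ≤ W') (hwL : ∀ e ∈ Icc lo hi, |wt e - wt lo| ≤ W' * (e - lo)) (hlohi : lo ≤ hi) (D : ℝ) :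
    ∀ e ∈ Icc lo hi, |wt e * χ (D - e) - wt lo * χ (D - lo)| ≤ (W' + W * Bχ₁) * (e - lo) := fun e he => by
  have hloI : lo ∈ Icc lo hi := left_mem_Icc.2 hlohi
  -- mean value for χ between D - e and D - lo
  have hmv : |χ (D - e) - χ (D - lo)| ≤ Bχ₁ * (e - lo) := by
    have h := Convex.norm_image_sub_le_of_norm_deriv_le (f := χ) (fun x _ => hχd x) (fun x _ => by rw [Real.norm_eq_abs]; exact hχ1 x) convex_univ
      (mem_univ (D - lo)) (mem_univ (D - e))
    rw [Real.norm_eq_abs, Real.norm_eq_abs, show D - e - (D - lo) = -(e - lo) by ring, abs_neg, abs_of_nonneg (sub_nonneg.2 he.1)] at h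
    exact h
  have h1 : |wt e - wt lo| * |χ (D - e)| ≤ W' * (e - lo) * 1 :=
    mul_le_mul (hwL e he) (hχ0 _) (abs_nonneg _) (mul_nonneg hW' (by linarith [he.1]))
  have h2 : |wt lo| * |χ (D - e) - χ (D - lo)| ≤ W * (Bχ₁ * (e - lo)) :=
    mul_le_mul (hwW lo hloI) hmv (abs_nonneg _) ((abs_nonneg _).trans (hwW lo hloI))
  calc |wt e * χ (D - e) - wt lo * χ (D - lo)| = |(wt e - wt lo) * χ (D - e) + wt lo * (χ (D - e) - χ (D - lo))| := by ring_nf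
    _ ≤ |(wt e - wt lo) * χ (D - e)| + |wt lo * (χ (D - e) - χ (D - lo))| := abs_add_le _ _
    _ = |wt e - wt lo| * |χ (D - e)| + |wt lo| * |χ (D - e) - χ (D - lo)| := by rw [abs_mul, abs_mul]
    _ ≤ W' * (e - lo) * 1 + W * (Bχ₁ * (e - lo)) := add_le_add h1 h2
    _ = (W' + W * Bχ₁) * (e - lo) := by ring

include hχ hχ1 hχ1r hrχ hlo hlohi hC1 in
/-- **Row `hflat`** transfers: given the flatness of `Kr` at the MODIFIED weight `wt·χ(D − ·)` and the value envelope `hK0`, the bumped family is flat with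
`Bfl ↦ (Bfl + W·B₁·r⁻¹·(hi − lo))/C`, `Afl ↦ Afl/C` (the `χ′(D−e)·Kr(e,D−e)` term lives on `|D − e| ≥ r`, where `|Kr| ≤ r⁻¹`). -/
theorem bumpKernel_hflat (hKd : ∀ e ∈ Icc (-hi) hi, ContDiff ℝ 1 (Kr e)) (hKc0 : Continuous fun p : ℝ × ℝ => Kr p.1 p.2)
    (hKc : Continuous fun p : ℝ × ℝ => deriv (Kr p.1) p.2) (hK0 : ∀ e ∈ Icc (-hi) hi, e ≠ 0 → ∀ u, |Kr e u| ≤ (max |e| |u|)⁻¹)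
    {wt : ℝ → ℝ} {W : ℝ} (hwc : ContinuousOn wt (Icc lo hi)) (hwW : ∀ e ∈ Icc lo hi, |wt e| ≤ W) {Afl Bfl Dfl : ℝ}
    (hflatχ : ∀ D : ℝ, 0 < D → D ≤ Dfl → |∫ e in lo..hi, (wt e * χ (D - e)) * deriv (Kr e) (D - e)| ≤ Afl * (lo / (max D lo) ^ 2) + Bfl) :
    ∀ D : ℝ, 0 < D → D ≤ Dfl → |∫ e in lo..hi, wt e * deriv (fun v => χ v * Kr e v / C) (D - e)| ≤
      Afl / C * (lo / (max D lo) ^ 2) + (Bfl + W * Bχ₁ * rχ⁻¹ * (hi - lo)) / C := fun D hD hDfl => by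
  have hχd : Differentiable ℝ χ := hχ.differentiable (by norm_num)
  have hC0 : 0 < C := by linarith
  have hB1 : 0 ≤ Bχ₁ := (abs_nonneg _).trans (hχ1 0)
  have hW0 : 0 ≤ W := (abs_nonneg _).trans (hwW lo (left_mem_Icc.2 hlohi))
  have hIcc : ∀ e ∈ Icc lo hi, e ∈ Icc (-hi) hi := fun e he => ⟨by linarith [he.1], he.2⟩
  -- rewrite the integrand
  have hderiv : ∀ e ∈ Icc lo hi, wt e * deriv (fun v => χ v * Kr e v / C) (D - e) =
      C⁻¹ * (wt e * (deriv χ (D - e) * Kr e (D - e))) + C⁻¹ * ((wt e * χ (D - e)) * deriv (Kr e) (D - e)) := fun e he => by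
    rw [deriv_bumpKernel hχd ((hKd e (hIcc e he)).differentiable one_ne_zero)]; ring
  have huIcc : uIcc lo hi = Icc lo hi := uIcc_of_le hlohi
  rw [intervalIntegral.integral_congr (fun e he => hderiv e (by rwa [huIcc] at he))]
  -- continuity / integrability of the two pieces on [lo, hi]
  have hc1 : ContinuousOn (fun e => wt e * (deriv χ (D - e) * Kr e (D - e))) (Icc lo hi) :=
    hwc.mul ((((hχ.continuous_deriv (by norm_num)).comp (continuous_const.sub continuous_id)).mul
      (hKc0.comp (continuous_id.prodMk (continuous_const.sub continuous_id)))).continuousOn)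
  have hc2 : ContinuousOn (fun e => (wt e * χ (D - e)) * deriv (Kr e) (D - e)) (Icc lo hi) :=
    (hwc.mul (hχ.continuous.comp (continuous_const.sub continuous_id)).continuousOn).mul
      (hKc.comp (continuous_id.prodMk (continuous_const.sub continuous_id))).continuousOn
  have hi1 : IntervalIntegrable (fun e => C⁻¹ * (wt e * (deriv χ (D - e) * Kr e (D - e)))) volume lo hi :=
    (ContinuousOn.intervalIntegrable (by rw [huIcc]; exact hc1)).const_mul _
  have hi2 : IntervalIntegrable (fun e => C⁻¹ * ((wt e * χ (D - e)) * deriv (Kr e) (D - e))) volume lo hi :=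
    (ContinuousOn.intervalIntegrable (by rw [huIcc]; exact hc2)).const_mul _
  rw [intervalIntegral.integral_add hi1 hi2, intervalIntegral.integral_const_mul, intervalIntegral.integral_const_mul]
  -- first piece: value envelope on the transition zone
  have hfirst : |∫ e in lo..hi, wt e * (deriv χ (D - e) * Kr e (D - e))| ≤ W * Bχ₁ * rχ⁻¹ * (hi - lo) := by
    have hb : ∀ e ∈ Ι lo hi, ‖wt e * (deriv χ (D - e) * Kr e (D - e))‖ ≤ W * Bχ₁ * rχ⁻¹ := fun e he => by
      have he' : e ∈ Icc lo hi := by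
        rw [uIoc_of_le hlohi] at he; exact ⟨he.1.le, he.2⟩
      have he0 : 0 < e := hlo.trans_le he'.1
      rw [Real.norm_eq_abs, abs_mul, abs_mul]
      by_cases hu : |D - e| ≤ rχ
      · rw [hχ1r _ hu, abs_zero, zero_mul, mul_zero]; positivity
      · push Not at hu
        have hKv : |Kr e (D - e)| ≤ rχ⁻¹ := by
          refine (hK0 e (hIcc e he') he0.ne' (D - e)).trans ?_
          exact inv_anti₀ hrχ (hu.le.trans (le_max_right _ _))
        calc |wt e| * (|deriv χ (D - e)| * |Kr e (D - e)|) ≤ W * (Bχ₁ * rχ⁻¹) :=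
              mul_le_mul (hwW e he') (mul_le_mul (hχ1 _) hKv (abs_nonneg _) hB1) (by positivity) hW0
          _ = W * Bχ₁ * rχ⁻¹ := by ring
    have h := intervalIntegral.norm_integral_le_of_norm_le_const hb
    rw [Real.norm_eq_abs, abs_of_nonneg (by linarith : (0 : ℝ) ≤ hi - lo)] at h
    linarith [h]
  have hsecond := hflatχ D hD hDfl
  have hCinv : 0 < C⁻¹ := inv_pos.2 hC0
  calc |(C⁻¹ * ∫ e in lo..hi, wt e * (deriv χ (D - e) * Kr e (D - e))) + C⁻¹ * ∫ e in lo..hi, (wt e * χ (D - e)) * deriv (Kr e) (D - e)|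
      ≤ C⁻¹ * |∫ e in lo..hi, wt e * (deriv χ (D - e) * Kr e (D - e))| + C⁻¹ * |∫ e in lo..hi, (wt e * χ (D - e)) * deriv (Kr e) (D - e)| := by
        refine (abs_add_le _ _).trans ?_
        rw [abs_mul, abs_mul, abs_of_pos hCinv]
    _ ≤ C⁻¹ * (W * Bχ₁ * rχ⁻¹ * (hi - lo)) + C⁻¹ * (Afl * (lo / (max D lo) ^ 2) + Bfl) := by gcongr
    _ = Afl / C * (lo / (max D lo) ^ 2) + (Bfl + W * Bχ₁ * rχ⁻¹ * (hi - lo)) / C := by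
        field_simp
        ring

include hχ hχ0 hχ1 hχ1r hC1 in
/-- **Row `hKn1`** transfers: with a value majorant `ρv` of `Kr(−s,·)` on the bump's transition zone (in the row's own shape), `ρm ↦ (ρm + B₁·ρv)/C`. -/
theorem bumpKernel_hKn1 (hKdiff : ∀ e, Differentiable ℝ (Kr e)) {ρm ρv : ℝ → ℝ}
    (hKn1 : ∀ s ∈ Icc lo hi, ∀ u, s / 2 ≤ u → |deriv (Kr (-s)) u| ≤ ρm s * ((max (u - s) lo)⁻¹ ^ 2))
    (hKn0 : ∀ s ∈ Icc lo hi, ∀ u, s / 2 ≤ u → rχ < |u| → |Kr (-s) u| ≤ ρv s * ((max (u - s) lo)⁻¹ ^ 2)) (hρv0 : ∀ s ∈ Icc lo hi, 0 ≤ ρv s) :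
    ∀ s ∈ Icc lo hi, ∀ u, s / 2 ≤ u → |deriv (fun v => χ v * Kr (-s) v / C) u| ≤ (ρm s + Bχ₁ * ρv s) / C * ((max (u - s) lo)⁻¹ ^ 2) :=
  fun s hs u hu => by
  have hχd : Differentiable ℝ χ := hχ.differentiable (by norm_num)
  have hC0 : 0 < C := by linarith
  have hB1 : 0 ≤ Bχ₁ := (abs_nonneg _).trans (hχ1 0)
  rw [deriv_bumpKernel hχd (hKdiff (-s)), abs_div, abs_of_pos hC0, div_mul_eq_mul_div]
  refine div_le_div_of_nonneg_right ?_ hC0.le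
  have hA : |deriv χ u * Kr (-s) u| ≤ Bχ₁ * ρv s * ((max (u - s) lo)⁻¹ ^ 2) := by
    by_cases hur : |u| ≤ rχ
    · rw [hχ1r u hur, zero_mul, abs_zero]; have := hρv0 s hs; positivity
    · push Not at hur
      rw [abs_mul]
      calc |deriv χ u| * |Kr (-s) u| ≤ Bχ₁ * (ρv s * ((max (u - s) lo)⁻¹ ^ 2)) :=
            mul_le_mul (hχ1 u) (hKn0 s hs u hu hur) (abs_nonneg _) hB1
        _ = _ := by ring
  have hB : |χ u * deriv (Kr (-s)) u| ≤ 1 * (ρm s * ((max (u - s) lo)⁻¹ ^ 2)) := by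
    rw [abs_mul]; exact mul_le_mul (hχ0 u) (hKn1 s hs u hu) (abs_nonneg _) zero_le_one
  calc |deriv χ u * Kr (-s) u + χ u * deriv (Kr (-s)) u| ≤ Bχ₁ * ρv s * ((max (u - s) lo)⁻¹ ^ 2) + 1 * (ρm s * ((max (u - s) lo)⁻¹ ^ 2)) :=
        (abs_add_le _ _).trans (add_le_add hA hB)
    _ = (ρm s + Bχ₁ * ρv s) * (max (u - s) lo)⁻¹ ^ 2 := by ring

/-- **Rows `hρ0`, `hρc`, `hρtail`** for the new majorant `(ρm + B₁ρv)/C`. -/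
theorem bumpKernel_hρ {ρm ρv : ℝ → ℝ} {Bχ₁ C Mρ Mv lo hi : ℝ} (hB1 : 0 ≤ Bχ₁) (hC0 : 0 < C)
    (hρ0 : ∀ s ∈ Icc lo hi, 0 ≤ ρm s) (hρc : ContinuousOn ρm (Icc lo hi)) (hρtail : ∀ a ∈ Icc lo hi, ∫ s in a..hi, ρm s ≤ Mρ * (lo * (lo / a) ^ 2))
    (hv0 : ∀ s ∈ Icc lo hi, 0 ≤ ρv s) (hvc : ContinuousOn ρv (Icc lo hi)) (hvtail : ∀ a ∈ Icc lo hi, ∫ s in a..hi, ρv s ≤ Mv * (lo * (lo / a) ^ 2)) :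
    (∀ s ∈ Icc lo hi, 0 ≤ (ρm s + Bχ₁ * ρv s) / C) ∧ ContinuousOn (fun s => (ρm s + Bχ₁ * ρv s) / C) (Icc lo hi) ∧
      ∀ a ∈ Icc lo hi, ∫ s in a..hi, (ρm s + Bχ₁ * ρv s) / C ≤ (Mρ + Bχ₁ * Mv) / C * (lo * (lo / a) ^ 2) := by
  refine ⟨fun s hs => div_nonneg (add_nonneg (hρ0 s hs) (mul_nonneg hB1 (hv0 s hs))) hC0.le,
    (hρc.add (continuousOn_const.mul hvc)).div_const C, fun a ha => ?_⟩
  have hsub : uIcc a hi ⊆ Icc lo hi := by rw [uIcc_of_le ha.2]; exact Icc_subset_Icc ha.1 le_rfl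
  have hi1 : IntervalIntegrable ρm volume a hi := (hρc.mono hsub).intervalIntegrable
  have hi2 : IntervalIntegrable (fun s => Bχ₁ * ρv s) volume a hi := ((hvc.mono hsub).intervalIntegrable).const_mul _
  have h : (fun s => (ρm s + Bχ₁ * ρv s) / C) = fun s => C⁻¹ * (ρm s + Bχ₁ * ρv s) := by funext s; rw [div_eq_inv_mul]
  rw [h, intervalIntegral.integral_const_mul, intervalIntegral.integral_add hi1 hi2, intervalIntegral.integral_const_mul]
  have h1 := hρtail a ha
  have h2 := hvtail a ha
  calc C⁻¹ * ((∫ s in a..hi, ρm s) + Bχ₁ * ∫ s in a..hi, ρv s) ≤ C⁻¹ * (Mρ * (lo * (lo / a) ^ 2) + Bχ₁ * (Mv * (lo * (lo / a) ^ 2))) := by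
        gcongr
    _ = (Mρ + Bχ₁ * Mv) / C * (lo * (lo / a) ^ 2) := by rw [div_eq_inv_mul]; ring

end Weighted

end Summit.HubbardSuperconductivity.HubbardSuperconductivity.Theorems.C4a

end
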